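import Summits.BirchSwinnertonDyer.BirchSwinnertonDyer.Theses.UniversalToricDescent
import Summits.BirchSwinnertonDyer.BirchSwinnertonDyer.Theorems.UniversalToricDescentToricTransportModThreeTwinMuZero
import Literature.NumberTheory.EllipticCurves.Hsieh2014.AnticyclotomicMuInvariantAnyLevel
import Summits.BirchSwinnertonDyer.BirchSwinnertonDyer.Theorems.UniversalToricDescentToricTransportModThreeNormProfile
import HarnessLib

/-!
# `μ = 0` for EVERY frame of the (∅,0) `3`-adic `L`-function of `f_E` ITSELF at the wild split prime, FROM
# PRINT (Hsieh 2014 Thm. B at every level, by name) — route `UniversalToricDescent`, crux #2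
# `ToricTransportModThree` (stmt-BirchSwinnertonDyer-20186), child `InvariantsTransportModThree` (20399)

Lead prover bsd-wall-utd-p1 g4 (`--supports stmt-BirchSwinnertonDyer-20399`, helper). Child 20399's conclusion
asks, for every `R₀`-frame `L` of `f_E` (E wild additive at `3`, `27 ∣ N` or `9 ∣ N`), a generator `g` of
`Ch_Λ(X_{∅,0}(E/K_∞))·R₀⟦T⟧` such that `g` and `L` have the same norm profile `(μ, λ) = (0, n)`. Its
why-might-fail prices ALL of it (alg, an, Σ) as beyond print at `9 ∣ N`. THIS FILE shows that the ANALYTIC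
`μ`-half is print by name, exactly as for the twin (child 20400, p540587): the tree's refereed fact
`Hsieh2014.thmB_exists_isHsiehLFunction_coeff_norm_eq_one_unrPeriod_anyLevel` (Doc. Math. 19 (2014) Thm. B =
Thm. 6.2, typed WITHOUT any condition on `v_p(N)` — ty-1 g9/g10 audit 2026-08-27: the level enters Hsieh's
Thm. 1/2 only through the prime-to-`p` conductor) applies to `f_E` itself: its binders are `p ≠ 2`, `K`
imaginary quadratic with `p` split, the classical Heegner hypothesis for `N`, absolute irreducibility of every
framing of `E[3]|_{Γ_K}` (from `ρ̄_{E,3}` onto, `[K:ℚ] = 2 < 3`), an auxiliary `λ` (tree `X11b.lambdaSupplyAt`),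
`κ` anticyclotomic with generator `γ`, and `ι′` inducing `𝔭` — NO reduction type at `p`.

* §1 `self_exists_isBDPLFunctionInt_coeff_norm_eq_one` — a ♭-frame `Q ∈ 𝓞_{ℂ_3}⟦T⟧` of `f_E` with Castella's
  interpolation property and a norm-one coefficient (Hsieh witness ⟹ ♭-frame by g3's any-`p` glue
  `exists_isBDPLFunctionInt_of_isHsiehLFunction_any`).
* §2 `self_forall_isBDPLFunction_coeff_norm_eq_one` — EVERY `R₀`-frame `L` of `f_E` (any non-zero periods)
  has a norm-one coefficient (`μ(L) = 0`), by the ♭ `μ`-transfer theorem p538896; stated on the E-side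
  telescope of the wall child 20395 (no twin binders); `self_forall_isBDPLFunctionInt_coeff_norm_eq_one` (♭).
* §3 `exists_normProfile_of_exists_coeff_norm_eq_one` — pure algebra: `μ(L) = 0` ⟹ `L` HAS a norm profile
  `(0, n)` (the least index of a norm-one coefficient); `normProfile_unique` — `n` is unique.
* §4 **`invariantsTransportModThree_of_algebraicTransport_of_thmB`** — child 20399 BY NAME from the print
  fact and the purely ALGEBRAIC transport statement «for every frame `L` with norm profile `(0, n)` there is a
  generator `g` of `Ch·R₀⟦T⟧` with norm profile `(0, n)`» (displayed hypothesis `hAlg`, the reshaped research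
  stub of line `gvtransport`; = `μ_alg(E) = 0 ∧ λ_alg(E) = λ_an(E)`, Greenberg–Vatsal's algebraic half).

HONEST STATUS: nothing of 20399's algebraic content is proved; the file moves its analytic `μ`-half to print
(conditional on the named fact `hB`, refereed) and isolates the remainder as ONE displayed statement.
No definition, no named fact minted, no `sorry`.
References: [Hsieh2014] Thm. B (Doc. Math. 19 p. 712) = arXiv:1112.1580 Thm. 2; [Castella2018] Thm. 3.1;
[GreenbergVatsal2000] Thm. 1.4 (shape of the algebraic transport).
-/

set_option linter.dupNamespace false
set_option autoImplicit false

noncomputable section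

open scoped Classical NumberField
open NumberField IsDedekindDomain Field PowerSeries
open Literature.NumberTheory.GaloisRepresentations
open Literature.NumberTheory.EllipticCurves
open Literature.NumberTheory.EllipticCurves.ModularForms
open Literature.NumberTheory.EllipticCurves.Rank1Residual
open Summit.BirchSwinnertonDyer.Rank1Residual
open Summit.BirchSwinnertonDyer.Rank1Residual.X11b

namespace Summit.BirchSwinnertonDyer.BirchSwinnertonDyer.Theorems.UniversalToricDescentSelfMuZero

open UniversalToricDescentTwinMuZero

/-! ### §1 A ♭-frame of `f_E` with a unit coefficient, FROM PRINT (Hsieh Thm. B at every level) -/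

/-- **`f_E` ITSELF HAS A ♭-FRAME WITH `μ = 0` AT THE WILD SPLIT PRIME, FROM PRINT.** Granted Hsieh 2014 Thm. B
at every level BY NAME (`hB`): for `E/ℚ` with `ρ̄_{E,3}` onto (ANY reduction at `3` — additive included),
`N = N(E)`, `K` imaginary quadratic with the classical Heegner hypothesis for `N`, `κ` anticyclotomic with
topological generator `γ`, `𝔭 ∋ 3` of degree one, `ι′` inducing `𝔭`, there is a ♭-frame
`(Ω_K ≠ 0, ‖Ω_p‖ = 1, Q ∈ 𝓞_{ℂ_3}⟦T⟧)` with `R1.IsBDPLFunctionInt 3 ι′ 𝔭 κ γ f_E Ω_K Ω_p Q` and a coefficient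
of norm `1`. CONDITIONAL on the published fact `hB` only.
[cite: Hsieh2014, Thm. B p. 712 (Doc. Math. 19) = Thm. 2 (arXiv:1112.1580 p. 4 ll. 31–38)]
[cite: Castella2018, Thm. 3.1 (arXiv:1704.06608 p. 9)] -/
theorem self_exists_isBDPLFunctionInt_coeff_norm_eq_one
    (hB : Hsieh2014.thmB_exists_isHsiehLFunction_coeff_norm_eq_one_unrPeriod_anyLevel)
    (W : WeierstrassCurve ℚ) [W.IsElliptic] (N : ℕ) [NeZero N]
    (K : Type) [Field K] [NumberField K] (Dt : ModularParametrizationData W N)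
    (honto : W.HasSurjectiveModNGaloisRep 3) (hK : IsImaginaryQuadratic K)
    (hH : SatisfiesHeegnerHypothesis N K) (κ : ZpExtension K 3) (hκ : κ.IsAnticyclotomic)
    (γ : Field.absoluteGaloisGroup K) [Fact (κ.IsTopGenerator γ)]
    (𝔭 : HeightOneSpectrum (𝓞 K)) (h𝔭 : ((3 : ℕ) : 𝓞 K) ∈ 𝔭.asIdeal)
    (he : 𝔭.asIdeal.ramificationIdx (𝓞 ℚ) = 1) (hf : 𝔭.asIdeal.inertiaDeg (𝓞 ℚ) = 1)
    (ι' : PadicAlgCl 3 ≃+* ℂ) (hι' : SchneiderFree.BranchInducesPrime 3 ι' 𝔭) :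
    ∃ (ΩK : ℂ) (Ωp : ℂ_[3]) (Q : PowerSeries 𝓞_ℂ_[3]), ΩK ≠ 0 ∧ ‖Ωp‖ = 1 ∧
      R1.IsBDPLFunctionInt 3 ι' 𝔭 κ γ Dt.f ΩK Ωp Q ∧
      ∃ i : ℕ, ‖((PowerSeries.coeff i Q : 𝓞_ℂ_[3]) : ℂ_[3])‖ = 1 := by
  have h32 : (3 : ℕ) ≠ 2 := by decide
  obtain ⟨lam, rlam, hu, hinfl, htriv, hunr, hav, hfac⟩ := lambdaSupplyAt h32 ι' K κ hK hκ
  have hlt : Module.finrank ℚ K < 3 := by rw [hK.1]; norm_num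
  have habs : ∀ ρ : ModPGaloisRep K (ZMod 3) 2, (W.baseChange K).IsTorsionGaloisRep 3 ρ →
      FramedRep.IsAbsolutelyIrreducible ρ := fun ρ hρ ↦
    SignedBaseChangeK1BigImage.irrM_framed_of_surj W 3 (by exact_mod_cast honto) K hlt ρ hρ
  have hsplit : ((Ideal.span {((3 : ℕ) : ℤ)}).primesOver (𝓞 K)).ncard = 2 :=
    SchneiderFree.ncard_primesOver_eq_two_of_degreeOne hK.1 h𝔭 he hf
  obtain ⟨A, ΩK, C, Ωp, Q, hA, hΩK, hC, hQ, hμ⟩ :=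
    hB ι' K 𝔭 κ γ W Dt.f lam rlam h32 Dt.isNewformOf hK hsplit h𝔭 hι' hH habs hu hinfl htriv hunr hav
      hfac hκ Fact.out
  obtain ⟨ΩK₁, c, hΩK₁, hc, hframe⟩ :=
    exists_isBDPLFunctionInt_of_isHsiehLFunction_any ι' 𝔭 κ γ Dt.f hA hΩK hC
      ((Ωp : unrIntegers 3) : ℂ_[3]) hQ
  exact ⟨ΩK₁, ((Ωp : unrIntegers 3) : ℂ_[3]), PowerSeries.C c * Q, hΩK₁,
    (unrIntegers.isUnit_iff_norm_eq_one _).mp Ωp.isUnit, hframe, exists_coeff_norm_eq_one_C_mul hc hμ⟩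

/-! ### §2 EVERY frame of `f_E` has `μ = 0` (both currencies) -/

/-- **`μ = 0` FOR EVERY `R₀`-FRAME OF `f_E` AT THE WILD SPLIT PRIME, FROM PRINT** — stated on the E-side
telescope of the wall child `AdditiveSplitIMCInclusionAtThree` (20395; no twin binders): for `E` wild at `3`
(`ClassO6`), `ρ̄_{E,3}` onto, `r_an = 1`, `N = N(E)`, `K` classical-Heegner for `N` with `3 = 𝔭𝔭′` split, `κ`
anticyclotomic, `𝔭` of degree one, `𝔭′ ≠ 𝔭`, `ι′` inducing `𝔭`, EVERY `R₀`-frame `(Ω_K ≠ 0, Ω_p ≠ 0, L)` of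
`f_E` has a coefficient of norm `1`. §1 gives a ♭-frame with a unit coefficient; the cross-period,
cross-receptacle `μ`-transfer is the THEOREM
`UniversalToricDescentFlatMuTransfer.exists_coeff_norm_eq_one_of_isBDPLFunctionInt_of_isBDPLFunction` (p538896).
The analytic `μ`-half of child 20399's conclusion; CONDITIONAL on the published fact `hB` only (several
telescope binders — `ClassO6`, `r_an = 1`, `𝔭′` — are idle and kept for registrability).
[cite: Hsieh2014, Thm. B p. 712 (Doc. Math. 19) = Thm. 2 (arXiv:1112.1580 p. 4 ll. 31–38)]
[cite: Castella2018, Thm. 3.1 (arXiv:1704.06608 p. 9)] -/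
theorem self_forall_isBDPLFunction_coeff_norm_eq_one
    (hB : Hsieh2014.thmB_exists_isHsiehLFunction_coeff_norm_eq_one_unrPeriod_anyLevel) :
  ∀ (W : WeierstrassCurve ℚ) [W.IsElliptic] [W.IsGloballyMinimal]
    (N : ℕ) [NeZero N] (K : Type) [Field K] [NumberField K]
    (Dt : Literature.NumberTheory.EllipticCurves.ModularForms.ModularParametrizationData W N),
    Summit.BirchSwinnertonDyer.Rank1Residual.Additive.ClassO6 W 3 → W.HasSurjectiveModNGaloisRep 3 →
    W.analyticRank = 1 → W.conductorNorm ℤ = N →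
    Literature.NumberTheory.EllipticCurves.IsImaginaryQuadratic K →
    Literature.NumberTheory.EllipticCurves.SatisfiesHeegnerHypothesis N K →
    ∀ (κ : Literature.NumberTheory.EllipticCurves.ZpExtension K 3), κ.IsAnticyclotomic →
      ∀ (γ : Field.absoluteGaloisGroup K) [Fact (κ.IsTopGenerator γ)]
        (𝔭 : IsDedekindDomain.HeightOneSpectrum (NumberField.RingOfIntegers K)),
        ((3 : ℕ) : NumberField.RingOfIntegers K) ∈ 𝔭.asIdeal →
        𝔭.asIdeal.ramificationIdx (NumberField.RingOfIntegers ℚ) = 1 →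
        𝔭.asIdeal.inertiaDeg (NumberField.RingOfIntegers ℚ) = 1 →
        ∀ (𝔭' : IsDedekindDomain.HeightOneSpectrum (NumberField.RingOfIntegers K)),
        ((3 : ℕ) : NumberField.RingOfIntegers K) ∈ 𝔭'.asIdeal → 𝔭' ≠ 𝔭 →
        ∀ (ι' : PadicAlgCl 3 ≃+* ℂ),
          Summit.BirchSwinnertonDyer.BirchSwinnertonDyer.Theorems.SchneiderFree.BranchInducesPrime 3 ι' 𝔭 →
          ∀ (ΩK : ℂ) (Ωp : ℂ_[3]) (L : Literature.NumberTheory.EllipticCurves.UnrSeries 3), ΩK ≠ 0 → Ωp ≠ 0 →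
            Literature.NumberTheory.EllipticCurves.IsBDPLFunction ι' 𝔭 κ γ Dt.f ΩK Ωp L →
            ∃ i : ℕ, ‖((PowerSeries.coeff i L : Literature.NumberTheory.EllipticCurves.unrIntegers 3) :
              ℂ_[3])‖ = 1 := by
  intro W _ _ N _ K _ _ Dt _hO6 honto _hr _hN hK hH κ hκ γ _ 𝔭 h𝔭 he hf _𝔭' _h𝔭' _hne ι' hι' ΩK Ωp L hΩK
    hΩp hL
  obtain ⟨ΩK₁, Ωp₁, Q, hΩK₁, hΩp₁, hQ, hμQ⟩ :=
    self_exists_isBDPLFunctionInt_coeff_norm_eq_one hB W N K Dt honto hK hH κ hκ γ 𝔭 h𝔭 he hf ι' hι'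
  have hΩp₁0 : Ωp₁ ≠ 0 := fun h ↦ by rw [h, norm_zero] at hΩp₁; exact zero_ne_one hΩp₁
  exact UniversalToricDescentFlatMuTransfer.exists_coeff_norm_eq_one_of_isBDPLFunctionInt_of_isBDPLFunction
    hK hκ Fact.out hΩK₁ hΩK hΩp₁0 hΩp hQ hL hμQ

/-- **In ♭ currency: every ♭-frame of `f_E` has `μ = 0`** (from §1 by x11b3's cross-period ♭ rigidity
`X11b.R1.exists_unit_mul_eq_of_isBDPLFunctionInt`, odd `p`, and `exists_coeff_norm_eq_one_of_isUnit_mul`).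
The reading the child would take under a ♭ re-type of the crux's frames. CONDITIONAL on `hB` only.
[cite: Hsieh2014, Thm. B p. 712 (Doc. Math. 19)] [cite: Castella2018, Thm. 3.1 (arXiv:1704.06608 p. 9)] -/
theorem self_forall_isBDPLFunctionInt_coeff_norm_eq_one
    (hB : Hsieh2014.thmB_exists_isHsiehLFunction_coeff_norm_eq_one_unrPeriod_anyLevel)
    (W : WeierstrassCurve ℚ) [W.IsElliptic] (N : ℕ) [NeZero N]
    (K : Type) [Field K] [NumberField K] (Dt : ModularParametrizationData W N)
    (honto : W.HasSurjectiveModNGaloisRep 3) (hK : IsImaginaryQuadratic K)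
    (hH : SatisfiesHeegnerHypothesis N K) (κ : ZpExtension K 3) (hκ : κ.IsAnticyclotomic)
    (γ : Field.absoluteGaloisGroup K) [Fact (κ.IsTopGenerator γ)]
    (𝔭 : HeightOneSpectrum (𝓞 K)) (h𝔭 : ((3 : ℕ) : 𝓞 K) ∈ 𝔭.asIdeal)
    (he : 𝔭.asIdeal.ramificationIdx (𝓞 ℚ) = 1) (hf : 𝔭.asIdeal.inertiaDeg (𝓞 ℚ) = 1)
    (ι' : PadicAlgCl 3 ≃+* ℂ) (hι' : SchneiderFree.BranchInducesPrime 3 ι' 𝔭)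
    {ΩK : ℂ} {Ωp : ℂ_[3]} {Q' : PowerSeries 𝓞_ℂ_[3]} (hΩK : ΩK ≠ 0) (hΩp : Ωp ≠ 0)
    (hQ' : R1.IsBDPLFunctionInt 3 ι' 𝔭 κ γ Dt.f ΩK Ωp Q') :
    ∃ i : ℕ, ‖((PowerSeries.coeff i Q' : 𝓞_ℂ_[3]) : ℂ_[3])‖ = 1 := by
  obtain ⟨ΩK₁, Ωp₁, Q, hΩK₁, hΩp₁, hQ, hμQ⟩ :=
    self_exists_isBDPLFunctionInt_coeff_norm_eq_one hB W N K Dt honto hK hH κ hκ γ 𝔭 h𝔭 he hf ι' hι'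
  have hΩp₁0 : Ωp₁ ≠ 0 := fun h ↦ by rw [h, norm_zero] at hΩp₁; exact zero_ne_one hΩp₁
  obtain ⟨U, hU, hUQ⟩ := R1.exists_unit_mul_eq_of_isBDPLFunctionInt (p := 3) (by decide) hK hκ Fact.out
    hΩK₁ hΩK hΩp₁0 hΩp hQ hQ'
  rw [hUQ]
  exact exists_coeff_norm_eq_one_of_isUnit_mul hU hμQ

/-! ### §3 Algebra: `μ = 0` ⟹ a norm profile `(0, n)` exists, and `n` is unique -/

section Algebra

variable {p : ℕ} [Fact p.Prime]

/-- **`μ(L) = 0` ⟹ `L` has a norm profile `(0, n)`**: if some coefficient of `L ∈ R₀⟦T⟧` has norm `1`, then for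
`n` the LEAST such index, every earlier coefficient has norm `< 1` (all coefficients have norm `≤ 1`). So the
clause "`∀ i < n, ‖[T^i]L‖ < 1 ∧ ‖[T^n]L‖ = 1`" of 20399 (`λ(L) = n`) is a CONSEQUENCE of `μ(L) = 0`.
[cite: Washington1997, §7.1 (μ and λ of a power series over 𝒪)] -/
theorem exists_normProfile_of_exists_coeff_norm_eq_one {L : UnrSeries p}
    (h : ∃ i : ℕ, ‖((PowerSeries.coeff i L : unrIntegers p) : ℂ_[p])‖ = 1) :
    ∃ n : ℕ, (∀ i < n, ‖((PowerSeries.coeff i L : unrIntegers p) : ℂ_[p])‖ < 1) ∧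
      ‖((PowerSeries.coeff n L : unrIntegers p) : ℂ_[p])‖ = 1 := by
  classical
  exact ⟨Nat.find h, fun i hi ↦
    lt_of_le_of_ne (UniversalToricDescentNormProfile.norm_coeff_le_one L i) (Nat.find_min h hi),
    Nat.find_spec h⟩

/-- **The norm profile is unique**: if `(0, m)` and `(0, n)` are both norm profiles of `L`, then `m = n`.
[cite: Washington1997, §7.1 (μ and λ of a power series over 𝒪)] -/
theorem normProfile_unique {L : UnrSeries p} {m n : ℕ}
    (hm : (∀ i < m, ‖((PowerSeries.coeff i L : unrIntegers p) : ℂ_[p])‖ < 1) ∧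
      ‖((PowerSeries.coeff m L : unrIntegers p) : ℂ_[p])‖ = 1)
    (hn : (∀ i < n, ‖((PowerSeries.coeff i L : unrIntegers p) : ℂ_[p])‖ < 1) ∧
      ‖((PowerSeries.coeff n L : unrIntegers p) : ℂ_[p])‖ = 1) : m = n := by
  by_contra hne
  rcases Nat.lt_or_gt_of_ne hne with h | h
  · exact absurd hm.2 (ne_of_lt (hn.1 m h))
  · exact absurd hn.2 (ne_of_lt (hm.1 n h))

end Algebra

/-! ### §4 Child 20399 BY NAME from print + the purely ALGEBRAIC transport -/

/-- **Child `InvariantsTransportModThree` (stmt-BirchSwinnertonDyer-20399) BY NAME from Hsieh 2014 Thm. B at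
every level (`hB`, refereed) and the ALGEBRAIC transport `hAlg`** — the reshaped research stub of line
`gvtransport`: on 20399's own telescope (twin binders and the three twin hypotheses included, since
Greenberg–Vatsal's mechanism uses the twin), «for every `R₀`-frame `L` of `f_E` with norm profile `(0, n)` there
is a generator `g` of `Ch_Λ(X_{∅,0}(E/K_∞))·R₀⟦T⟧` with norm profile `(0, n)`» (= `μ_alg(E) = 0` and
`λ_alg(E) = λ_an(E)`). Proof: §2 gives `μ(L) = 0`, §3 a profile `(0, n)` of `L`, `hAlg` the generator.
So 20399 = print (analytic `μ`) + `hAlg` (beyond print at `9 ∣ N`: Σ-imprimitive residual Selmer comparison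
over `K_∞`, no finite submodule, congruence of the `3`-depleted measures for `λ`).
[cite: GreenbergVatsal2000, Thm. 1.4 (shape of the algebraic transport)]
[cite: Hsieh2014, Thm. B p. 712 (Doc. Math. 19)] -/
theorem invariantsTransportModThree_of_algebraicTransport_of_thmB
    (hB : Hsieh2014.thmB_exists_isHsiehLFunction_coeff_norm_eq_one_unrPeriod_anyLevel)
    (hAlg : ∀ (W : WeierstrassCurve ℚ) [W.IsElliptic] [W.IsGloballyMinimal]
      (W' : WeierstrassCurve ℚ) [W'.IsElliptic] [W'.IsGloballyMinimal]
      (N N' : ℕ) [NeZero N] [NeZero N'] (K : Type) [Field K] [NumberField K]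
      (Dt : Literature.NumberTheory.EllipticCurves.ModularForms.ModularParametrizationData W N)
      (Dt' : Literature.NumberTheory.EllipticCurves.ModularForms.ModularParametrizationData W' N'),
      Summit.BirchSwinnertonDyer.Rank1Residual.Additive.ClassO6 W 3 → W.HasSurjectiveModNGaloisRep 3 →
      W.analyticRank = 1 → W.conductorNorm ℤ = N →
      Summit.BirchSwinnertonDyer.Rank1Residual.O6.ModPCongruent W' W 3 →
      ¬ Literature.NumberTheory.EllipticCurves.Rank1Residual.Addv W' 3 → W'.conductorNorm ℤ = N' →
      Literature.NumberTheory.EllipticCurves.IsImaginaryQuadratic K →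
      Literature.NumberTheory.EllipticCurves.SatisfiesHeegnerHypothesis N K →
      Literature.NumberTheory.EllipticCurves.SatisfiesHeegnerHypothesis N' K →
      ∀ (κ : Literature.NumberTheory.EllipticCurves.ZpExtension K 3), κ.IsAnticyclotomic →
        ∀ (γ : Field.absoluteGaloisGroup K) [Fact (κ.IsTopGenerator γ)]
          (𝔭 : IsDedekindDomain.HeightOneSpectrum (NumberField.RingOfIntegers K)),
          ((3 : ℕ) : NumberField.RingOfIntegers K) ∈ 𝔭.asIdeal →
          𝔭.asIdeal.ramificationIdx (NumberField.RingOfIntegers ℚ) = 1 →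
          𝔭.asIdeal.inertiaDeg (NumberField.RingOfIntegers ℚ) = 1 →
          ∀ (𝔭' : IsDedekindDomain.HeightOneSpectrum (NumberField.RingOfIntegers K)),
          ((3 : ℕ) : NumberField.RingOfIntegers K) ∈ 𝔭'.asIdeal → 𝔭' ≠ 𝔭 →
          ∀ (ι' : PadicAlgCl 3 ≃+* ℂ),
            Summit.BirchSwinnertonDyer.BirchSwinnertonDyer.Theorems.SchneiderFree.BranchInducesPrime 3 ι' 𝔭 →
            (∃ (ΩK : ℂ) (Ωp : ℂ_[3]) (L' : Literature.NumberTheory.EllipticCurves.UnrSeries 3),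
                ΩK ≠ 0 ∧ Ωp ≠ 0 ∧ Literature.NumberTheory.EllipticCurves.IsBDPLFunction ι' 𝔭 κ γ Dt'.f ΩK Ωp L') →
            (∀ (ΩK : ℂ) (Ωp : ℂ_[3]) (L' : Literature.NumberTheory.EllipticCurves.UnrSeries 3), ΩK ≠ 0 → Ωp ≠ 0 →
                Literature.NumberTheory.EllipticCurves.IsBDPLFunction ι' 𝔭 κ γ Dt'.f ΩK Ωp L' →
                (AcSelmer.XAc.charIdeal (W'.baseChange K) 3 κ 𝔭' ∅ γ).map
                  (PowerSeries.map (Halves.toUnr 3)) = Ideal.span {L'}) →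
            (∀ (ΩK : ℂ) (Ωp : ℂ_[3]) (L' : Literature.NumberTheory.EllipticCurves.UnrSeries 3), ΩK ≠ 0 → Ωp ≠ 0 →
                Literature.NumberTheory.EllipticCurves.IsBDPLFunction ι' 𝔭 κ γ Dt'.f ΩK Ωp L' →
                ∃ i : ℕ, ‖((PowerSeries.coeff i L' : Literature.NumberTheory.EllipticCurves.unrIntegers 3) :
                  ℂ_[3])‖ = 1) →
            ∀ (ΩK : ℂ) (Ωp : ℂ_[3]) (L : Literature.NumberTheory.EllipticCurves.UnrSeries 3), ΩK ≠ 0 → Ωp ≠ 0 →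
              Literature.NumberTheory.EllipticCurves.IsBDPLFunction ι' 𝔭 κ γ Dt.f ΩK Ωp L →
              ∀ n : ℕ, (∀ i < n, ‖((PowerSeries.coeff i L : Literature.NumberTheory.EllipticCurves.unrIntegers 3) :
                  ℂ_[3])‖ < 1) →
                ‖((PowerSeries.coeff n L : Literature.NumberTheory.EllipticCurves.unrIntegers 3) : ℂ_[3])‖ = 1 →
                ∃ g : Literature.NumberTheory.EllipticCurves.UnrSeries 3,
                  (AcSelmer.XAc.charIdeal (W.baseChange K) 3 κ 𝔭' ∅ γ).map
                    (PowerSeries.map (Halves.toUnr 3)) = Ideal.span {g} ∧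
                  (∀ i < n, ‖((PowerSeries.coeff i g : Literature.NumberTheory.EllipticCurves.unrIntegers 3) :
                    ℂ_[3])‖ < 1) ∧
                  ‖((PowerSeries.coeff n g : Literature.NumberTheory.EllipticCurves.unrIntegers 3) : ℂ_[3])‖ = 1) :
    Summit.BirchSwinnertonDyer.BirchSwinnertonDyer.Theses.UniversalToricDescent.InvariantsTransportModThree := by
  intro W _ _ W' _ _ N N' _ _ K _ _ Dt Dt' hO6 honto hr hN hcong haddv hN' hK hH hH' κ hκ γ _ 𝔭 h𝔭 he hf 𝔭'
    h𝔭' hne ι' hι' hex heq' hμ' ΩK Ωp L hΩK hΩp hL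
  have hμ : ∃ i : ℕ, ‖((PowerSeries.coeff i L : unrIntegers 3) : ℂ_[3])‖ = 1 :=
    self_forall_isBDPLFunction_coeff_norm_eq_one hB W N K Dt hO6 honto hr hN hK hH κ hκ γ 𝔭 h𝔭 he hf 𝔭'
      h𝔭' hne ι' hι' ΩK Ωp L hΩK hΩp hL
  obtain ⟨n, hLl, hLn⟩ := exists_normProfile_of_exists_coeff_norm_eq_one hμ
  obtain ⟨g, hI, hgl, hgn⟩ := hAlg W W' N N' K Dt Dt' hO6 honto hr hN hcong haddv hN' hK hH hH' κ hκ γ 𝔭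
    h𝔭 he hf 𝔭' h𝔭' hne ι' hι' hex heq' hμ' ΩK Ωp L hΩK hΩp hL n hLl hLn
  exact ⟨g, n, hI, hgl, hgn, hLl, hLn⟩

end Summit.BirchSwinnertonDyer.BirchSwinnertonDyer.Theorems.UniversalToricDescentSelfMuZero

end
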